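import Literature.Analysis.FluidPDE.NavierStokesReynolds
import HarnessLib

/-!
# The local corrector of the Cheskidov–Luo concentration step (CL22, §3.1 and Prop. 3.2), named fact

A. Cheskidov, X. Luo, *Sharp nonuniqueness for the Navier–Stokes equations*, Invent. Math. 229
(2022) 987–1054 = arXiv:2009.06596 (numbering of the held arXiv copy), prove their concentration
step (Prop. 3.1, the named fact `Torus.CheskidovLuo2022Concentration` of
`Literature.Analysis.FluidPDE.NavierStokesReynoldsSteps`) from ONE analytic input, isolated here as
the named fact `Torus.CheskidovLuo2022Corrector`, and a gluing-and-bookkeeping argument (§§3.2–3.3,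
cut-offs `χᵢ`, the concentrated stress (3.6), Prop. 3.3), which is PROVED in the sequel files
`NavierStokesConcentration*` of this directory.

The analytic input (§3.1 and Prop. 3.2): given a smooth solution `(u, p, R)` of the
Navier–Stokes–Reynolds system (2.1) on `[0, T] × 𝕋^d`, on every short interval `[a, a + θ] ⊆ [0, T]`
the *generalised Navier–Stokes system linearised around `u` and forced by `-div R`*,

  `∂ₜv - Δv + div (v ⊗ v) + div (v ⊗ u) + div (u ⊗ v) + ∇q = -div R`, `div v = 0`, `v(a) = 0`  (3.2)

has a smooth solution ("thanks to the general local wellposedness theory of the Navier–Stokes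
equations … for all sufficiently small `τ > 0`, we may solve equation (3.2) on intervals
`t ∈ [tᵢ, tᵢ₊₁]` to obtain a unique smooth solution `vᵢ`", §3.1), which is small when the
interval is short, uniformly in the position `a` of the interval, and whose antidivergence is
controlled in `L^r` by the stress forcing (Prop. 3.2: "`‖vᵢ‖_{L^∞([tᵢ,tᵢ₊₁]; H^d(𝕋^d))} ≤ δ` and
`‖ℛvᵢ‖_{L^∞([tᵢ,tᵢ₊₁]; L^r(𝕋^d))} ≤ C_r ∫_{[tᵢ,tᵢ₊₁]} ‖R(t)‖_{L^r} dt + C_u δ τ^ε`"). This is the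
only place where the proof of Prop. 3.1 uses PDE theory (local well-posedness of a forced
Navier–Stokes-type system in `H^d`, the heat flow of `z = ℛv` and the Calderón–Zygmund bound
for `ℛℙdiv` on `L^r(𝕋^d)`, `1 < r < ∞`); none of it exists in Mathlib or in this library on the
torus at this pin (the tree's local regular solutions, `Literature.Analysis.FluidPDE.local_regular_solution_exists`,
files `NSFourier*`, are on the whole space and unforced), so it is recorded as a named fact
(`def … : Prop`, D-0014) to be discharged separately; see "Rendering" in its docstring for the
exact form, which is the form CONSUMED by the gluing argument.

## Mathlib / tree search

`lean search 'Corrector|wellposed|IsClassicalNSSolutionOn'`: no local existence theorem for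
(forced or unforced) Navier–Stokes on `UnitAddTorus` in the tree; whole-space: `NSLocalRegular`,
`NSFourierRestart` (proved), `TaoH1LocalExistence` (fact). Vocabulary reused:
`Torus.IsNSReynoldsOn`, `FunctionSpaces.Torus.IsSmoothSpaceTimeOn`, `.timeDerivWithin`, `.convect`,
`.gradient`, `.laplacian`, `.IsDivFree`, `.HasZeroMean`, `Torus.tensorDivergence`, Mathlib's
`eLpNorm` and `intervalIntegral`.

## References

* A. Cheskidov, X. Luo, *Sharp nonuniqueness for the Navier–Stokes equations*, Invent. Math. 229
  (2022), 987–1054; arXiv:2009.06596: §3.1 (3.2) and the paragraph following it, Prop. 3.2 and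
  its proof, §7.2 Def. 7.2 (the antidivergence `ℛ`). [`CheskidovLuo2022`]
* A. J. Majda, A. L. Bertozzi, *Vorticity and Incompressible Flow*, CUP 2002, Thm. 3.4 (local
  `H^m` existence for Navier–Stokes, the "general local wellposedness theory" invoked in §3.1).
  [`MajdaBertozzi2002`]
-/

open MeasureTheory Set Filter
open scoped InnerProductSpace ContDiff ENNReal NNReal

noncomputable section

namespace Literature.Analysis.FluidPDE

namespace Torus

variable {d : Type*} [Fintype d] [DecidableEq d]

/-- **A corrector of the concentration step on the time interval `[a, b]`** (Cheskidov–Luo 2022,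
§3.1, system (3.2), together with the conclusions of Prop. 3.2 in the form the gluing of §3.2
uses them): around the background velocity `u` and stress `R`, the data `(v, q, A, π)` — velocity
and pressure correctors, an antidivergence of `v` and its gradient part — satisfy
* `v`, `q`, `A`, `π` are jointly `C^∞` on `[a, b] × 𝕋^d` (one-sided in time at `a`, `b`);
* the generalised Navier–Stokes system (3.2) in convective form,
  `∂ₜv + (v·∇)v + (u·∇)v + (v·∇)u + ∇q = Δv - div R`, `div v = 0` on `[a, b]`, `v(a) = 0`
  ("`∂ₜvᵢ - Δvᵢ + div(vᵢ ⊗ vᵢ) + div(vᵢ ⊗ u) + div(u ⊗ vᵢ) + ∇qᵢ = -div R`, `div vᵢ = 0`,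
  `vᵢ(tᵢ) = 0`"; for divergence-free `u`, `v` the two forms agree), with `v(t)`, `q(t)`, `π(t)` of
  zero mean ("(3.2) preserves the zero-mean condition"; the pressure normalisations are free);
* `A(t)` is symmetric and trace free and `v = div A + ∇π` (the rôle of `ℛvᵢ`, §7.2 Def. 7.2:
  "`div ℛv = v`" for zero-mean `v`, `ℛv ∈ 𝒮₀^{d×d}`; here a gradient part `∇π` is allowed);
* the smallness `‖v(t, x)‖ ≤ δ` (print: `‖vᵢ‖_{L^∞H^d} ≤ δ`, and `H^d(𝕋^d) ↪ L^∞`) and the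
  antidivergence bound `‖A(t)‖_{L^r} ≤ C ∫ₐᵇ ‖R(s)‖_{L^r} ds + K` for `t ∈ [a, b]` (print:
  `‖ℛvᵢ‖_{L^∞([tᵢ,tᵢ₊₁];L^r)} ≤ C_r ∫_{[tᵢ,tᵢ₊₁]} ‖R‖_{L^r} + C_u δ τ^ε`, i.e. `K = C_u δ τ^ε`), with
  `L^r = eLpNorm · (ENNReal.ofReal r)` of the slices (stress by columns, column-sup pointwise norm,
  as in `Torus.IsNSReynoldsOn`).
[cite: CheskidovLuo2022, §3.1 (3.2) and Prop. 3.2] -/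
structure IsCorrector (u : ℝ → UnitAddTorus d → EuclideanSpace ℝ d)
    (R : ℝ → UnitAddTorus d → d → EuclideanSpace ℝ d) (r C K δ a b : ℝ)
    (v : ℝ → UnitAddTorus d → EuclideanSpace ℝ d) (q : ℝ → UnitAddTorus d → ℝ)
    (A : ℝ → UnitAddTorus d → d → EuclideanSpace ℝ d) (π : ℝ → UnitAddTorus d → ℝ) : Prop where
  /-- The velocity corrector is jointly smooth on `[a, b] × 𝕋^d`. -/
  smooth_v : FunctionSpaces.Torus.IsSmoothSpaceTimeOn (Icc a b) v
  /-- The pressure corrector is jointly smooth on `[a, b] × 𝕋^d`. -/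
  smooth_q : FunctionSpaces.Torus.IsSmoothSpaceTimeOn (Icc a b) q
  /-- The antidivergence is jointly smooth on `[a, b] × 𝕋^d`. -/
  smooth_A : FunctionSpaces.Torus.IsSmoothSpaceTimeOn (Icc a b) A
  /-- The gradient part is jointly smooth on `[a, b] × 𝕋^d`. -/
  smooth_π : FunctionSpaces.Torus.IsSmoothSpaceTimeOn (Icc a b) π
  /-- System (3.2) in convective form, with the one-sided time derivative within `[a, b]`. -/
  momentum : ∀ t ∈ Icc a b, ∀ x,
    FunctionSpaces.Torus.timeDerivWithin (Icc a b) v t x +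
          FunctionSpaces.Torus.convect (v t) (v t) x + FunctionSpaces.Torus.convect (u t) (v t) x +
          FunctionSpaces.Torus.convect (v t) (u t) x +
        FunctionSpaces.Torus.gradient (q t) x =
      FunctionSpaces.Torus.laplacian (v t) x - tensorDivergence (R t) x
  /-- `div v(t) = 0`. -/
  divFree : ∀ t ∈ Icc a b, FunctionSpaces.Torus.IsDivFree (v t)
  /-- Zero initial datum `v(a) = 0`. -/
  initial : ∀ x, v a x = 0
  /-- `v(t)` has zero mean. -/
  hasZeroMean_v : ∀ t ∈ Icc a b, FunctionSpaces.Torus.HasZeroMean (v t)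
  /-- `q(t)` has zero mean. -/
  hasZeroMean_q : ∀ t ∈ Icc a b, FunctionSpaces.Torus.HasZeroMean (q t)
  /-- `π(t)` has zero mean. -/
  hasZeroMean_π : ∀ t ∈ Icc a b, FunctionSpaces.Torus.HasZeroMean (π t)
  /-- `A(t)` is symmetric. -/
  symm : ∀ t ∈ Icc a b, ∀ x, ∀ i j : d, A t x i j = A t x j i
  /-- `A(t)` is trace free. -/
  traceFree : ∀ t ∈ Icc a b, ∀ x, ∑ i, A t x i i = 0
  /-- `v = div A + ∇π`. -/
  eq_div_add_grad : ∀ t ∈ Icc a b, ∀ x,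
    v t x = tensorDivergence (A t) x + FunctionSpaces.Torus.gradient (π t) x
  /-- The smallness `‖v(t, x)‖ ≤ δ`. -/
  norm_le : ∀ t ∈ Icc a b, ∀ x, ‖v t x‖ ≤ δ
  /-- The antidivergence bound `‖A(t)‖_{L^r} ≤ C ∫ₐᵇ ‖R(s)‖_{L^r} ds + K`. -/
  eLpNorm_le : ∀ t ∈ Icc a b,
    eLpNorm (A t) (ENNReal.ofReal r) volume ≤
      ENNReal.ofReal (C * (∫ s in a..b, (eLpNorm (R s) (ENNReal.ofReal r) volume).toReal) + K)

/-- **The zero corrector.** Where the stress vanishes identically on `[a, b] × 𝕋^d`, the zero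
data `(v, q, A, π) = 0` are a corrector for any `δ ≥ 0` and any constants `C`, `K` (CL22, §3.3:
"it follows from (3.2) that `vᵢ ≡ 0` for `i` such that `R ≡ 0` on `[tᵢ, tᵢ₊₁]`"; here by fiat
rather than by uniqueness). [cite: CheskidovLuo2022, §3.3] -/
theorem IsCorrector.zero {u : ℝ → UnitAddTorus d → EuclideanSpace ℝ d}
    {R : ℝ → UnitAddTorus d → d → EuclideanSpace ℝ d} {r C K δ a b : ℝ}
    (hδ : 0 ≤ δ) (hR : ∀ t ∈ Icc a b, ∀ x, R t x = 0) :
    IsCorrector u R r C K δ a b (fun _ _ => 0) (fun _ _ => 0) (fun _ _ _ => 0) (fun _ _ => 0) where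
  smooth_v := contDiffOn_const
  smooth_q := contDiffOn_const
  smooth_A := contDiffOn_const
  smooth_π := contDiffOn_const
  momentum t ht x := by
    have hR0 : R t = fun _ _ => 0 := by
      funext y j; rw [hR t ht y]; rfl
    have h1 : FunctionSpaces.Torus.convect (fun _ : UnitAddTorus d => (0 : EuclideanSpace ℝ d)) (u t) x = 0 := by
      simp [FunctionSpaces.Torus.convect]
    rw [hR0, tensorDivergence_zero, h1]
    simp
  divFree t _ x := by simp
  initial _ := rfl
  hasZeroMean_v _ _ := by simp [FunctionSpaces.Torus.HasZeroMean]
  hasZeroMean_q _ _ := by simp [FunctionSpaces.Torus.HasZeroMean]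
  hasZeroMean_π _ _ := by simp [FunctionSpaces.Torus.HasZeroMean]
  symm _ _ _ _ _ := rfl
  traceFree _ _ _ := by simp
  eq_div_add_grad t _ x := by
    rw [tensorDivergence_zero, gradient_zero, add_zero]
  norm_le _ _ _ := by simpa using hδ
  eLpNorm_le t _ := by
    have h0 : (fun _ : UnitAddTorus d => fun _ : d => (0 : EuclideanSpace ℝ d)) = 0 := rfl
    rw [h0, eLpNorm_zero]
    exact bot_le

/-- **Cheskidov–Luo 2022, §3.1 + Prop. 3.2 (existence of the local correctors), named fact — in
the form the proof of Prop. 3.1 consumes.** Printed (viscosity `1`, `d ≥ 2`, `T = 1`,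
`tᵢ = iτ^ε`, `0 ≤ i ≤ τ^{-ε} - 1`, "we assume `τ^{-ε}` is always an integer so that the time
interval `[0,1]` is perfectly divided"): "let `vᵢ : [tᵢ, tᵢ₊₁] × 𝕋^d → ℝ^d` and `qᵢ` be the
solution of the generalized Navier–Stokes system (3.2) … Since the initial data for `vᵢ` is zero
and `u` and `R` are smooth on `[0,1] × 𝕋^d`, thanks to the general local wellposedness theory of
the Navier–Stokes equations …, for all sufficiently small `τ > 0`, we may solve equation (3.2) on
intervals `t ∈ [tᵢ, tᵢ₊₁]` to obtain a unique smooth solution `vᵢ`." and **Prop. 3.2**: "Let `d ≥ 2`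
and `(u, R)` be a smooth solution of (2.1). There exists a universal constant `C_r > 0` depending
on `1 < r < ∞` so that the following holds. For any `δ > 0`, if `τ > 0` is sufficiently small, then
the unique smooth solutions `vᵢ` to (3.2) on `[tᵢ, tᵢ₊₁]` satisfies
`‖vᵢ‖_{L^∞([tᵢ,tᵢ₊₁]; H^d(𝕋^d))} ≤ δ`, and
`‖ℛvᵢ‖_{L^∞([tᵢ,tᵢ₊₁]; L^r(𝕋^d))} ≤ C_r ∫_{[tᵢ,tᵢ₊₁]} ‖R(t)‖_{L^r} dt + C_u δ τ^ε`, where `C_u` is a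
sufficiently large constant depending on `u` but not `δ` or `τ`" (its proof: "Assuming `δ > 0`
is sufficiently small, we prove the second one").
**Rendering.** `card d ≥ 2`; the background is a `Torus.IsNSReynoldsOn (Icc 0 T) 1 u P R` triple
on `[0, T]`, `T > 0` (print `T = 1`), and the grid is `tᵢ = iT/n`, `0 ≤ i < n`, for every
sufficiently fine subdivision `n ≥ n₀` (print: `n = τ^{-ε}`, "all sufficiently small `τ`"); the
quantifier order is the printed dependence of the constants: `C = C_r > 0` after `r` only
("universal"), then the background, then `C_u ≥ 0` and the threshold `δ₀ > 0` of "`δ` sufficiently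
small" (depending on the background only), then `δ ∈ (0, δ₀]`, then `n₀`. On each grid interval
the conclusion is `Torus.IsCorrector u R r C (C_u δ (T/n)) δ tᵢ tᵢ₊₁ v q A π` (see that structure
for the clause-by-clause rendering: convective form of (3.2), pointwise smallness for the
`H^d`-smallness, and `(A, π)` with `v = div A + ∇π` for `ℛvᵢ` — the printed bound is the case
`A = ℛvᵢ`, `π = 0`, so allowing `π` weakens the fact). Uniqueness of `vᵢ` is not recorded (unused
downstream). The proof (local well-posedness of (3.2) in `H^d` on short intervals, uniformly in
`i` by the smoothness of `u`, `R` on the compact `[0, T] × 𝕋^d`; the heat equation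
`∂ₜz - Δz = F` for `z = ℛvᵢ` and the Calderón–Zygmund bound for `ℛℙdiv` on `L^r(𝕋^d)`,
`1 < r < ∞`; cf. Majda–Bertozzi 2002, Thm. 3.4 for the local `H^m` theory) is not formalised.
[cite: CheskidovLuo2022, §3.1 (3.2) and Prop. 3.2] -/
def CheskidovLuo2022Corrector : Prop :=
  2 ≤ Fintype.card d → ∀ (r : ℝ), 1 < r → ∃ C : ℝ, 0 < C ∧
    ∀ (T : ℝ), 0 < T →
      ∀ (u : ℝ → UnitAddTorus d → EuclideanSpace ℝ d) (P : ℝ → UnitAddTorus d → ℝ)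
        (R : ℝ → UnitAddTorus d → d → EuclideanSpace ℝ d),
        IsNSReynoldsOn (Icc 0 T) 1 u P R →
        ∃ Cu δ₀ : ℝ, 0 ≤ Cu ∧ 0 < δ₀ ∧ ∀ (δ : ℝ), 0 < δ → δ ≤ δ₀ → ∃ n₀ : ℕ, 0 < n₀ ∧
          ∀ (n : ℕ), n₀ ≤ n → ∀ (i : ℕ), i < n →
            ∃ (v : ℝ → UnitAddTorus d → EuclideanSpace ℝ d) (q : ℝ → UnitAddTorus d → ℝ)
              (A : ℝ → UnitAddTorus d → d → EuclideanSpace ℝ d) (π : ℝ → UnitAddTorus d → ℝ),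
              IsCorrector u R r C (Cu * δ * (T / n)) δ (i * (T / n)) ((i + 1) * (T / n)) v q A π

end Torus

end Literature.Analysis.FluidPDE
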